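import Mathlib
import HarnessLib
import Literature.MathematicalPhysics.StatisticalMechanics.PolymerReblockingMap

/-!
# The closure of a polymer has fewer blocks: `|X̄|_{j+1} ≤ |X|_j`, with a gain `η > 1` for large
# connected polymers (Brydges 2009, Lemma 6.15; [ABKM19] App. A, Lemma A.1)

In the contraction estimate for the linearised renormalisation map ([ABKM19] Lemma 10.2, via
App. A) the reblocking of a LARGE connected `k`-polymer `X` (more than `2^d` blocks) onto
`π(X) = X̄` gains a factor `A^{|π(X)|_{k+1} − |X|_k}` because the number of blocks strictly drops:
Brydges' Lemma 6.15 gives a dimensional constant `η(d) > 1` with `|X|_k ≥ η |X̄|_{k+1}` for all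
large connected `X` once `L ≥ 2^d + 1`, while `|X|_k ≥ |X̄|_{k+1}` holds for every `X`.

* `card_blocks_closure_le` — **proved**: `|X̄|_{k+1} ≤ |X|_k` for every set `X` (each
  `(k+1)`-block of the closure contains a `k`-block of `X`; odd sides, `s' = L s`);
* `card_polys_subset_le` — **proved**: the number of `k`-polymers inside a `k`-polymer `U` is at
  most `2^{|U|_k}` (the counting "by `2^{L^d|U|_{j+1}}`" of Brydges' Lemma 6.18 / [ABKM19] Lemma A.2);
* `BrydgesClosureGain d` — the NAMED FACT (statement only) of Brydges 2009, Lemma 6.15, in the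
  tree's torus vocabulary (centred blocks of odd side, `ℓ^∞`-connectedness of
  `LongRangePhi4.Polymer.IsConn`): `∃ η > 1, ∀ odd L ≥ 2^d + 1, … , |X|_k ≥ η |X̄|_{k+1}` for large
  connected `X`.  Not proved here (induction on `|X̄|_{k+1}` removing connected subsets of
  `2^d + 1` blocks; [Bry09] pp. 72–73).
  -- TODO(general form): Brydges states it for any `L ≥ 2^d + 1` with corner blocks on `ℤ^d`/the
  -- torus; the centred odd paving used by [ABKM19] is the case recorded here.

## References
* D. C. Brydges, *Lectures on the renormalisation group*, IAS/Park City Math. Ser. 16 (2009),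
  Lemma 6.15 (and Lemma 6.18 for the counting) [Brydges2009].
* S. Adams, S. Buchholz, R. Kotecký, S. Müller, arXiv:1910.13564, App. A (Lemmas A.1, A.2), proof
  of Lemma 10.2 [AdamsBuchholzKoteckyMuller2019].
-/

noncomputable section

namespace Literature.MathematicalPhysics.StatisticalMechanics.TorusPolymer

open scoped BigOperators Classical
open Finset
open Literature.Barriers.CriticalPhenomena.LongRangePhi4.Polymer (IsConn)

variable {d M : ℕ} [NeZero M]

/-! ## `|X̄|_{k+1} ≤ |X|_k` -/

/-- **`|X̄|_{k+1} ≤ |X|_k`** for every set `X` (odd block sides `s`, `s' = L s`): each `(k+1)`-block of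
the closure `X̄` meets `X`, and the `k`-block of a meeting point lies inside that `(k+1)`-block, so
distinct `(k+1)`-blocks of `X̄` receive distinct `k`-blocks of `X`.
[cite: Brydges2009, Lemma 6.15 ("(6.71) holds with η = 1 for all X")] -/
theorem card_blocks_closure_le {s L : ℕ} (hs : Odd s) (hL : Odd L) (X : Finset (Fin d → ZMod M)) :
    (blocks (L * s) (closure (L * s) X)).card ≤ (blocks s X).card := by
  -- the closure of a `k`-block `B_x` is the `(k+1)`-block of `x`
  have hcl : ∀ x : Fin d → ZMod M, closure (L * s) (blockOf s x) = blockOf (L * s) x := by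
    intro x
    apply Subset.antisymm
    · exact closure_subset_of_isPolymer (blockOf_subset_blockOf_mul hs hL x) (isPolymer_blockOf _ x)
    · intro y hy
      exact mem_closure.2 ⟨x, mem_blockOf_self s x, mem_blockOf.1 hy⟩
  -- `B ↦ closure B` maps `𝓑_k(X)` onto `𝓑_{k+1}(X̄)`
  refine Finset.card_le_card_of_surjOn (fun B => closure (L * s) B) fun B' hB' => ?_
  obtain ⟨y, hy, rfl⟩ := mem_blocks.1 (Finset.mem_coe.1 hB')
  obtain ⟨x, hx, hxy⟩ := mem_closure.1 hy
  refine ⟨blockOf s x, Finset.mem_coe.2 (mem_blocks.2 ⟨x, hx, rfl⟩), ?_⟩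
  simp only [hcl]
  exact blockOf_eq_of_mem (mem_blockOf.2 hxy.symm) |>.symm ▸ (blockOf_eq_of_mem (mem_blockOf.2 hxy)).symm

/-! ## Counting polymers inside a polymer -/

/-- **At most `2^{|𝓑_k(U)|}` `k`-polymers lie inside a set `U`** (`X ↦ 𝓑_k(X) ⊆ 𝓑_k(U)` is
injective on polymers). [cite: Brydges2009, Lemma 6.18 (proof: "estimating the number of sets X by 2^{L^d|U|_{j+1}}")] -/
theorem card_polys_le_two_pow (s : ℕ) (U : Finset (Fin d → ZMod M)) :
    (polys s U).card ≤ 2 ^ (blocks s U).card := by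
  rw [← Finset.card_powerset]
  refine Finset.card_le_card_of_injOn (fun X => blocks s X) (fun X hX => ?_) (fun X₁ hX₁ X₂ hX₂ h => ?_)
  · exact mem_powerset.2 (blocks_mono s (mem_polys.1 hX).1)
  · have h1 := (mem_polys.1 hX₁).2.biUnion_blocks
    have h2 := (mem_polys.1 hX₂).2.biUnion_blocks
    rw [← h1, ← h2]
    simp only at h
    rw [h]

/-! ## Brydges' gain `η > 1` for large connected polymers (named fact) -/

/-- **Brydges 2009, Lemma 6.15** (the geometric gain of the reblocking step; [ABKM19] App. A,
Lemma A.1 uses it as `|X|_k ≥ (1 + 2η(d))|π(X)|_{k+1}` for non-small `X`): there is a dimensional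
constant `η = η(d) > 1` such that for all `L ≥ 2^d + 1` and all LARGE CONNECTED `k`-polymers `X`
(connected in the `ℓ^∞` sense, more than `2^d` blocks) the closure has `|X|_k ≥ η |X̄|_{k+1}`.
Recorded on the torus `(ℤ/M)^d` with the centred paving of [ABKM19] (odd `s`, `L`, `M = L·s·t`).
Statement only (named fact); the proof in the source is an induction on `|X̄|_{k+1}` removing a
connected subset of `2^d + 1` blocks at a time.
[cite: Brydges2009, Lemma 6.15] -/
def BrydgesClosureGain (d : ℕ) : Prop :=
  ∃ η : ℝ, 1 < η ∧ ∀ (L s t : ℕ) (M : ℕ) [NeZero M], Odd L → Odd s → Odd t → 2 ^ d + 1 ≤ L →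
    M = L * s * t → ∀ X : Finset (Fin d → ZMod M), IsPolymer s X → IsConn X →
      2 ^ d < (blocks s X).card →
        η * ((blocks (L * s) (closure (L * s) X)).card : ℝ) ≤ ((blocks s X).card : ℝ)

end Literature.MathematicalPhysics.StatisticalMechanics.TorusPolymer

end
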